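import Literature.Probability.LatticeModels.GaussianPairingBound
import Literature.Probability.LatticeModels.PlusFreeComparison
import Literature.Probability.LatticeModels.FreeStateGibbs
import HarnessLib

/-!
# Aizenman's bound on the deviation of the `2n`-point function from Wick's law (Aizenman 1982, Prop. 12.1)

Topic `Literature/Probability/LatticeModels`; family `crit-ising` (crit-ising.S13, the input of
Aizenman–Duminil-Copin 2021, Prop. 1.4). This file vendors, **in the form printed by its
source**, the upper bound of

* M. Aizenman, *Geometric analysis of `φ⁴` fields and Ising models, Parts I and II*, Comm. Math.
  Phys. **86** (1982) 1–48, §12 "Bounds for the higher correlation functions",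
  **Proposition 12.1**, eq. (12.3) (p. 37): with
  `G_{2n}(x₁,…,x_{2n}) = ∑_{pairings} ∏ S₂` ("the Gaussian component", p. 36) and
  `R_{2n}(x₁,…,x_{2n}) = ∑_{1≤j<k<l<m≤2n} |U₄(x_j,x_k,x_l,x_m)| G_{2n-4}(…,x̸_j,…,x̸_k,…,x̸_l,…,x̸_m,…)`,
  "in a `φ⁴` field theory described by (9.4), or a ferromagnetic Ising system,
  `… ≤ |S_{2n}(x₁,…,x_{2n}) - G_{2n}(x₁,…,x_{2n})| ≤ (3/2) R_{2n}(x₁,…,x_{2n})`", proved there for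
  "finite systems of Ising spins, with a general two point ferromagnetic interaction" through
  the random-walk representation of §9 (Prop. 9.3, Lemmas 9.2–9.3, eqs. (12.5)–(12.7));
* restated as M. Aizenman, *A geometric perspective on the scaling limits of critical Ising and
  `φ⁴_d` models*, CDM 2020 (arXiv:2112.04248), **Proposition 7.2** ("[1] (Theorem 12.1)"),
  eq. (7.1): `0 ≤ G_{2n}[S₂](x) - S_{2n}(x) ≤ -(3/2) ∑_{j<k<l<m} U₄(x_j,x_k,x_l,x_m) · G_{2n-4}[S₂](…)`;
* and as R. Panis, arXiv:2309.05797, **Proposition 4.6** "Deviation from Wick's law" (`d ≥ 2`,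
  `n ≥ 2`; `|U₄^β|` and "the pairing sum of `{1,…,2n} ∖ {i,j,k,l}`").

## Why a new named fact

Aizenman–Duminil-Copin, Ann. of Math. 194 (2021) = arXiv:1912.07973, §6.3, p. 26, first
display, quotes the inequality "derived using the switching lemma in [Aiz82]" with the
`(2n-4)`-point function `S_β(x₁,…,x̸_i,…,x̸_j,…,x̸_k,…,x̸_l,…,x_{2n})` in place of the Wick
functional `G_{2n-4}`; the tree's named facts `aizenman_pairingSum_sub_nPoint_le`,
`aizenman_pairingSum_sub_nPoint_le_finite` and the property `PairingUpperBound`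
(`HighDimTrivialityWick`, Part J), and downstream the moment form
`aizenman_evenMoment_deviation_le` (`HighDimTrivialityMoments`), record that quotation
verbatim. Since `-U₄ ≥ 0` (Lebowitz) and `S_{2n-4} ≤ G_{2n-4}` (Newman), the quoted form is
*stronger* than the theorem of [Aiz82] (whose proof, (12.5)–(12.7), yields `G_{2n-4}`), so
those named facts, though harmless as hypotheses, are not known to be dischargeable as stated
(`PairingUpperBound.wickDeviationBound` below records the implication ADC-form ⇒ source form).
This file records the source form and re-derives from it everything the tree derives from the
quoted form: the smeared moment bound (with the Gaussian `(2n-4)`-th moment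
`(2n-4)!/(2^{n-2}(n-2)!) ⟨T_{|f|,L}²⟩^{n-2}` in place of `⟨T_{|f|,L}^{2n-4}⟩`), the summation
over `n` (the same constant `24`), and Aizenman–Duminil-Copin's Prop. 1.4 in the form its proof
establishes (`aizenmanDuminilCopin_mgf_normalizedField_bound_abs`). The barrier
`Literature.Barriers.CriticalPhenomena.IsingTrivialityFromDimensionFour` and the derived shape
`criticalSmearedMGF_bound_four_nonneg` are re-threaded onto this fact in the sibling barrier
proof file `IsingTrivialityFromDimensionFourWick`.

## Contents

* Part 1. `removeFour₂` (the remaining points indexed by `Fin (2(n-2))`), Aizenman's remainder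
  `wickRemainder S₂ U₄ n x = R_{2n}(x)`, and the **named fact** (D-0014)
  `aizenman_wickDeviation_le_finite`: on every finite simple graph with unit couplings, free
  boundary condition, zero field, `β ≥ 0`: `|S_{2n} - G_{2n}| ≤ (3/2) R_{2n}` for `n ≥ 2`
  (Aizenman 1982, Prop. 12.1, upper bound in (12.3)).
* Part 2. Transport to finite volumes `Λ ⊂ ℤ^d` (`wickDeviation_le_box`; the free measure of
  `Λ` is the Ising model of the induced graph, `isingExpect_free_map`).
* Part 3. `WickDeviationBound μ` (the same inequality as a property of a state on `ℤ^d`) and its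
  passage to every state whose correlations are the free box limits
  (`wickDeviationBound_of_finite`); the implication from the tree's `PairingUpperBound`.
* Part 4. Smearing: `abs_integral_normalizedField_pow_sub_le_of_wickBounds`,
  `|⟨T_{f,L}^{2n}⟩ - (2n-1)!! ⟨T_{f,L}²⟩ⁿ| ≤ (3/2)(2n)⁴ ‖f‖_∞⁴ S(μ;L,r) · (2n-5)!! ⟨T_{|f|,L}²⟩^{n-2}`
  (Aizenman CDM 2020, (7.6) and (7.9)–(7.10); Panis 2023, proof of Thm 5.5).
* Part 5. Summation over `n` (`abs_mgf_sub_exp_le_of_wickMoment_bounds`, pure probability) and the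
  one-state exponential-moment bound `abs_mgf_normalizedField_sub_exp_le_of_wickBounds`
  (constant `24`, prefactor `exp(z²⟨T_{|f|,L}²⟩/2)`).
* Part 6. `aizenmanDuminilCopin_mgf_normalizedField_bound_abs` (ADC Prop. 1.4 in the form its
  proof establishes) from `aizenman_wickDeviation_le_finite`, the `d = 4` bound on `∑ |U₄|`
  (`aizenmanDuminilCopin_ursellFourSum_le`, ADC Thm 1.3 + §6.3) and uniqueness of the Gibbs
  state up to `β_c` — the corrected counterpart of
  `aizenmanDuminilCopin_mgf_normalizedField_bound_abs_of_finite` (`HighDimTrivialityWick`).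

## Mathlib

`Fin.cast`, `Fintype.piFinset`, `Finset.orderEmbOfFin` (through `restrictFour`/`removeFour` of
`HighDimTrivialityWick`), `MeasureTheory.hasSum_integral_of_summable_integral_norm` (through
`hasSum_integral_pow_div_factorial`), `NormedSpace.expSeries_div_hasSum_exp`, `hasSum_le`.
Mathlib has no Ising model / Wick pairings; `pairingSum` is the tree's.
-/

noncomputable section

open MeasureTheory Finset Filter Topology
open scoped Nat

namespace Literature.Probability.LatticeModels

/-! ### Part 1. Aizenman's remainder `R_{2n}` and Proposition 12.1 (upper bound) as a named fact -/

/-- `2(n-2) = 2n-4` in `ℕ`. [folklore] -/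
theorem two_mul_sub_two (n : ℕ) : 2 * (n - 2) = 2 * n - 4 := by omega

/-- For a `4`-subset `s` of the indices, the remaining `2n-4 = 2(n-2)` points
`(x_1,…,x̸_i,…,x̸_j,…,x̸_k,…,x̸_l,…,x_{2n})` in increasing order of index, indexed by
`Fin (2(n-2))` so that the pairing functional `𝒢_{n-2}` applies (`removeFour` of
`HighDimTrivialityWick` reindexed along `Fin.cast`). [folklore] -/
def removeFour₂ {α : Type*} {n : ℕ} (x : Fin (2 * n) → α)
    (s : {s : Finset (Fin (2 * n)) // s.card = 4}) : Fin (2 * (n - 2)) → α :=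
  removeFour x s ∘ Fin.cast (two_mul_sub_two n)

/-- **Aizenman's remainder** `R_{2n}(x₁,…,x_{2n}) = ∑_{1≤j<k<l<m≤2n} |U₄(x_j,x_k,x_l,x_m)| ·
G_{2n-4}(…,x̸_j,…,x̸_k,…,x̸_l,…,x̸_m,…)`, with `G_{2m} = 𝒢_m[S₂]` the Gaussian (Wick) pairing
functional of the two-point function `S₂` (`pairingSum`) and `U₄` the four-point Ursell function
(Aizenman 1982, Prop. 12.1, definition of `R_{2n}`, p. 37; the sum runs over the `4`-element
subsets `s` of the index set, `restrictFour x s` the selected points, `removeFour₂ x s` the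
remaining ones). [cite: AizenmanCMP1982, Prop. 12.1 (definition of R_{2n}, p. 37)] -/
def wickRemainder {α : Type*} (S₂ : α → α → ℝ) (U₄ : (Fin 4 → α) → ℝ) (n : ℕ)
    (x : Fin (2 * n) → α) : ℝ :=
  ∑ s : {s : Finset (Fin (2 * n)) // s.card = 4},
    |U₄ (restrictFour x s)| * pairingSum S₂ (n - 2) (removeFour₂ x s)

/-- **NAMED FACT — Aizenman 1982, Proposition 12.1 (upper bound): the deviation of the
`2n`-point function from Wick's law.** "In a `φ⁴` field theory described by (9.4), or a
ferromagnetic Ising system, let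
`R_{2n}(x₁,…,x_{2n}) = ∑_{1≤j<k<l<m≤2n} |U₄(x_j,…,x_m)| G_{2n-4}(…,x̸_j,…,x̸_k,…,x̸_l,…,x̸_m,…)`,
where `x̸` indicates an omitted site. Then `… ≤ |S_{2n}(x₁,…,x_{2n}) - G_{2n}(x₁,…,x_{2n})| ≤
(3/2) R_{2n}(x₁,…,x_{2n})`" (Comm. Math. Phys. 86 (1982), Prop. 12.1, eq. (12.3), p. 37), with
`G_{2n}(x₁,…,x_{2n}) = ∑_{pairings T} ∏_k S₂(x_{Tk}, x_{T(k+n)})` "the Gaussian component"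
(p. 36); "it suffices to prove [it] for finite systems of Ising spins, with a general two point
ferromagnetic interaction … The cases with coincidental points are easily reduced" (p. 37);
proof by the random-walk representation, Prop. 9.3 and Lemmas 9.2–9.3, eqs. (12.5)–(12.7).
Restated with the same right-hand side (Wick functional `G_{2n-4}` of the remaining points) in
Aizenman, CDM 2020, Prop. 7.2, eq. (7.1) ("[1] (Theorem 12.1)") and in Panis 2023, Prop. 4.6.
Vendored for the nearest-neighbour ferromagnetic Ising model with unit couplings on the edges
of an arbitrary finite simple graph `G` (a special ferromagnetic pair interaction), free
boundary condition, zero field, `β ≥ 0` (`isingMeasure G univ β 0 free`), all `n ≥ 2` and all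
`x : Fin (2n) → V` (coincident points allowed): `|S_{2n}(x) - 𝒢_n[S₂](x)| ≤ (3/2) R_{2n}(x)`
with `S_{2n} = nPoint`, `S₂ = twoPoint`, `U₄ = connectedFour` (`Correlations`), `𝒢 = pairingSum`
(`HighDimTrivialityWick`), `R_{2n} = wickRemainder`. **Not** the form quoted in
Aizenman–Duminil-Copin 2021, §6.3, first display (which has `S_{2n-4}` for `G_{2n-4}`; see the
module docstring and `aizenman_pairingSum_sub_nPoint_le_finite`). Named fact (D-0014); the
random-walk representation of [Aiz82, §9] is not in the tree.
[cite: AizenmanCMP1982, Prop. 12.1, eq. (12.3) upper bound (p. 37), proof (12.5)–(12.7)] [cite: AizenmanCDM2020, Prop. 7.2, eq. (7.1)] [cite: Panis2023Triviality, Prop. 4.6] -/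
def aizenman_wickDeviation_le_finite : Prop :=
  ∀ (V : Type) [Fintype V] [DecidableEq V] (G : SimpleGraph V) [DecidableRel G.Adj] (β : ℝ),
    0 ≤ β → ∀ n : ℕ, 2 ≤ n → ∀ x : Fin (2 * n) → V,
      |nPoint (isingMeasure G univ β 0 .free) spinAt x -
          pairingSum (twoPoint (isingMeasure G univ β 0 .free) spinAt) n x| ≤
        3 / 2 * wickRemainder (twoPoint (isingMeasure G univ β 0 .free) spinAt)
          (connectedFour (isingMeasure G univ β 0 .free) spinAt) n x

/-! #### Congruence: `R_{2n}` only sees the correlation values -/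

/-- `restrictFour` commutes with relabelling the points. [folklore] -/
theorem restrictFour_comp {α α' : Type*} {n : ℕ} (g : α → α') (x : Fin (2 * n) → α)
    (s : {s : Finset (Fin (2 * n)) // s.card = 4}) :
    restrictFour (g ∘ x) s = g ∘ restrictFour x s := rfl

/-- `removeFour₂` commutes with relabelling the points. [folklore] -/
theorem removeFour₂_comp {α α' : Type*} {n : ℕ} (g : α → α') (x : Fin (2 * n) → α)
    (s : {s : Finset (Fin (2 * n)) // s.card = 4}) :
    removeFour₂ (g ∘ x) s = g ∘ removeFour₂ x s := rfl

/-- The remainder `R_{2n}` only depends on the values `S₂ (x i) (x j)` and `U₄ (x ∘ e)`,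
`e : Fin 4 → Fin (2n)`. [folklore] -/
theorem wickRemainder_congr_of_eq {α α' : Type*} (S : α → α → ℝ) (S' : α' → α' → ℝ)
    (U : (Fin 4 → α) → ℝ) (U' : (Fin 4 → α') → ℝ) (n : ℕ)
    (x : Fin (2 * n) → α) (x' : Fin (2 * n) → α') (hS : ∀ i j, S (x i) (x j) = S' (x' i) (x' j))
    (hU : ∀ e : Fin 4 → Fin (2 * n), U (x ∘ e) = U' (x' ∘ e)) :
    wickRemainder S U n x = wickRemainder S' U' n x' := by
  unfold wickRemainder
  refine Finset.sum_congr rfl fun s _ => ?_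
  congr 1
  · exact congrArg _ (hU _)
  · exact pairingSum_congr_of_eq S S' (n - 2) _ _ fun i j => hS _ _

/-! ### Part 2. Transport to finite volumes of `ℤ^d` -/

section Box

variable {d : ℕ}

/-- **Aizenman's Prop. 12.1 in a finite volume `Λ ⊂ ℤ^d`** (free boundary condition, zero
field, `β ≥ 0`, `n ≥ 2`, `x₁,…,x_{2n} ∈ Λ`): granted `aizenman_wickDeviation_le_finite`,
`|⟨σ_{x₁}⋯σ_{x_{2n}}⟩_{Λ,β} - 𝒢_n[⟨σσ⟩_{Λ,β}](x)| ≤ (3/2) R_{2n}^{Λ,β}(x)`. The free measure of the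
volume `Λ` is the Ising model of the graph induced on `Λ` (`isingExpect_free_map`), to which
the finite-graph statement applies (same transport as `aizenman_nPoint_le_pairingSum_finite_holds`).
[cite: AizenmanCMP1982, Prop. 12.1, eq. (12.3) (p. 37)] -/
theorem wickDeviation_le_box (hW : aizenman_wickDeviation_le_finite) (Λ : Finset (Site d))
    {β : ℝ} (hβ : 0 ≤ β) {n : ℕ} (hn : 2 ≤ n) (x : Fin (2 * n) → Site d) (hx : ∀ i, x i ∈ Λ) :
    |nPoint (isingMeasure (zdGraph d) Λ β 0 .free) spinAt x -
        pairingSum (twoPoint (isingMeasure (zdGraph d) Λ β 0 .free) spinAt) n x| ≤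
      3 / 2 * wickRemainder (twoPoint (isingMeasure (zdGraph d) Λ β 0 .free) spinAt)
        (connectedFour (isingMeasure (zdGraph d) Λ β 0 .free) spinAt) n x := by
  classical
  -- the graph induced on `Λ`, on the vertex type `↥Λ`
  set ι : ↥Λ ↪ Site d := Function.Embedding.subtype (· ∈ Λ) with hι
  set GΛ : SimpleGraph ↥Λ := (zdGraph d).comap ι with hGΛ
  set x' : Fin (2 * n) → ↥Λ := fun i => ⟨x i, hx i⟩ with hx'
  have hmap : (univ : Finset ↥Λ).map ι = Λ := by
    rw [hι, Finset.univ_eq_attach, Finset.attach_map_val]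
  have hadj : ∀ a ∈ (univ : Finset ↥Λ), ∀ b ∈ (univ : Finset ↥Λ),
      ((zdGraph d).Adj (ι a) (ι b) ↔ GΛ.Adj a b) := fun _ _ _ _ => Iff.rfl
  -- transport of the expectations of spin monomials
  have hE : ∀ {m : ℕ} (y : Fin m → ↥Λ),
      nPoint (isingMeasure (zdGraph d) Λ β 0 .free) spinAt (fun i => (y i : Site d)) =
        nPoint (isingMeasure GΛ univ β 0 .free) spinAt y := by
    intro m y
    have key := isingExpect_free_map (G := GΛ) (G' := zdGraph d) ι (Λ := univ) hadj β 0
      (measurable_spinMonomial fun i => (y i : Site d))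
    rw [hmap] at key
    change isingExpect (zdGraph d) Λ β 0 .free (spinMonomial fun i => (y i : Site d)) =
      isingExpect GΛ univ β 0 .free (spinMonomial y)
    rw [key]
    congr 1
    funext σ
    simp only [spinMonomial]
    exact Finset.prod_congr rfl fun i _ => spinAt_extendAlong ι σ (y i)
  have hx_eq : x = fun i => (x' i : Site d) := rfl
  have hN : nPoint (isingMeasure (zdGraph d) Λ β 0 .free) spinAt x =
      nPoint (isingMeasure GΛ univ β 0 .free) spinAt x' := hE x'
  have h2pt : ∀ a b : ↥Λ, twoPoint (isingMeasure (zdGraph d) Λ β 0 .free) spinAt (a : Site d) b =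
      twoPoint (isingMeasure GΛ univ β 0 .free) spinAt a b := by
    intro a b
    rw [twoPoint_eq_nPoint, twoPoint_eq_nPoint]
    have := hE ![a, b]
    refine Eq.trans ?_ this
    congr 1
    funext l
    fin_cases l <;> rfl
  have h2 : ∀ i j, twoPoint (isingMeasure (zdGraph d) Λ β 0 .free) spinAt (x i) (x j) =
      twoPoint (isingMeasure GΛ univ β 0 .free) spinAt (x' i) (x' j) := fun i j => h2pt (x' i) (x' j)
  have hU : ∀ e : Fin 4 → Fin (2 * n),
      connectedFour (isingMeasure (zdGraph d) Λ β 0 .free) spinAt (x ∘ e) =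
        connectedFour (isingMeasure GΛ univ β 0 .free) spinAt (x' ∘ e) := by
    intro e
    simp only [connectedFour, Function.comp_apply, h2]
    rw [show (x ∘ e) = fun i => ((x' ∘ e) i : Site d) from rfl, hE (x' ∘ e)]
  rw [hN, pairingSum_congr_of_eq _ _ n x x' h2,
    wickRemainder_congr_of_eq _ _ _ _ n x x' h2 hU]
  exact hW (↥Λ) GΛ β hβ n hn x'

end Box

/-! ### Part 3. The bound as a property of a state on `ℤ^d`; passage to the limit -/

section State

variable {d : ℕ}

/-- **Aizenman's Prop. 12.1 for one state `μ` on `ℤ^d`**: for all `n ≥ 2` and `x₁,…,x_{2n}`,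
`|S_{2n}^μ(x) - 𝒢_n[S₂^μ](x)| ≤ (3/2) ∑_{s} |U₄^μ(x_s)| 𝒢_{n-2}[S₂^μ](x^{(s̸)})` (the form of
Aizenman 1982, (12.3) / Aizenman CDM 2020, (7.1) / Panis 2023, Prop. 4.6, as a property of a
state; compare `PairingUpperBound` of `HighDimTrivialityWick`, the ADC 2021 quotation).
[cite: AizenmanCMP1982, Prop. 12.1, eq. (12.3)] [cite: AizenmanCDM2020, Prop. 7.2, eq. (7.1)] -/
def WickDeviationBound (μ : Measure (SpinConfig (Site d))) : Prop :=
  ∀ n : ℕ, 2 ≤ n → ∀ x : Fin (2 * n) → Site d,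
    |nPoint μ spinAt x - pairingSum (twoPoint μ spinAt) n x| ≤
      3 / 2 * wickRemainder (twoPoint μ spinAt) (connectedFour μ spinAt) n x

/-- `R_{2n}` is continuous in the correlation values (a polynomial in finitely many of them). [folklore] -/
theorem tendsto_wickRemainder {α ι : Type*} {l : Filter ι} {S : ι → α → α → ℝ} {S₀ : α → α → ℝ}
    {U : ι → (Fin 4 → α) → ℝ} {U₀ : (Fin 4 → α) → ℝ}
    (hS : ∀ a b, Tendsto (fun i => S i a b) l (𝓝 (S₀ a b)))
    (hU : ∀ u, Tendsto (fun i => U i u) l (𝓝 (U₀ u))) (n : ℕ) (x : Fin (2 * n) → α) :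
    Tendsto (fun i => wickRemainder (S i) (U i) n x) l (𝓝 (wickRemainder S₀ U₀ n x)) := by
  unfold wickRemainder
  exact tendsto_finsetSum _ fun s _ => ((hU _).abs).mul (tendsto_pairingSum hS (n - 2) _)

/-- **Passage to the limit.** Granted `aizenman_wickDeviation_le_finite`, every state whose
correlations are the free box limits (`spinCorr μ A = freeCorr d β 0 A`) satisfies
`WickDeviationBound μ` (both sides converge along the boxes `Λ_L`, `L → ∞`:
`tendsto_nPoint_box_free`, `tendsto_twoPoint_box_free`, `tendsto_connectedFour_box_free` of
`HighDimTrivialityWick`, Part M). This is the infinite-volume statement of Panis 2023,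
Prop. 4.6 / Aizenman CDM 2020, Prop. 7.2 for such states. [cite: Panis2023Triviality, Prop. 4.6] [cite: AizenmanCMP1982, Prop. 12.1] -/
theorem wickDeviationBound_of_finite (hW : aizenman_wickDeviation_le_finite) {β : ℝ}
    (hβ : 0 ≤ β) {μ : Measure (SpinConfig (Site d))}
    (hcorr : ∀ A : Finset (Site d), spinCorr μ A = freeCorr d β 0 A) : WickDeviationBound μ := by
  intro n hn x
  have hT := fun a b => tendsto_twoPoint_box_free hβ hcorr a b
  have hC := fun u => tendsto_connectedFour_box_free hβ hcorr u
  refine le_of_tendsto_of_tendsto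
    (((tendsto_nPoint_box_free hβ hcorr x).sub (tendsto_pairingSum hT n x)).abs)
    (Tendsto.const_mul _ (tendsto_wickRemainder hT hC n x)) ?_
  filter_upwards [eventually_forall_mem_box x] with L hL
  exact wickDeviation_le_box hW (box d L) hβ hn x hL

/-- `𝒢_0[S₂] = 1` (the empty pairing). [folklore] -/
theorem pairingSum_zero {α : Type*} (S₂ : α → α → ℝ) (x : Fin (2 * 0) → α) :
    pairingSum S₂ 0 x = 1 := by
  simp [pairingSum]

/-- `𝒢_1[S₂](a, b) = (S₂(a,b) + S₂(b,a))/2`, i.e. `S₂(a, b)` for a symmetric `S₂`. [folklore] -/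
theorem pairingSum_one {α : Type*} (S₂ : α → α → ℝ) (hS : ∀ a b, S₂ a b = S₂ b a)
    (x : Fin (2 * 1) → α) : pairingSum S₂ 1 x = S₂ (x 0) (x 1) := by
  unfold pairingSum
  have hperm : (Finset.univ : Finset (Equiv.Perm (Fin (2 * 1)))) = {1, Equiv.swap 0 1} := by
    ext τ
    simp only [Finset.mem_univ, Finset.mem_insert, Finset.mem_singleton, true_iff]
    rcases Fin.exists_fin_two.mp ⟨τ 0, rfl⟩ with h0 | h0
    · left
      ext i
      fin_cases i
      · simp [h0]
      · have h1 : τ 1 = 1 := by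
          rcases Fin.exists_fin_two.mp ⟨τ 1, rfl⟩ with h1 | h1
          · exact absurd (τ.injective (h1.trans h0.symm)) (by decide)
          · exact h1
        simp [h1]
    · right
      ext i
      fin_cases i
      · simp [h0]
      · have h1 : τ 1 = 0 := by
          rcases Fin.exists_fin_two.mp ⟨τ 1, rfl⟩ with h1 | h1
          · exact h1
          · exact absurd (τ.injective (h1.trans h0.symm)) (by decide)
        simp [h1]
  have hne : (1 : Equiv.Perm (Fin (2 * 1))) ≠ Equiv.swap 0 1 := by
    intro h
    have := congrArg (fun τ : Equiv.Perm (Fin (2 * 1)) => τ 0) h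
    simp at this
  rw [hperm, Finset.sum_pair hne]
  have hp0 : (pairIdx 1 (0, 0) : Fin (2 * 1)) = 0 := Fin.ext (by rw [pairIdx_apply_val]; simp)
  have hp1 : (pairIdx 1 (0, 1) : Fin (2 * 1)) = 1 := Fin.ext (by rw [pairIdx_apply_val]; simp)
  simp only [Fin.prod_univ_one, hp0, hp1, Equiv.Perm.one_apply, Equiv.swap_apply_left,
    Equiv.swap_apply_right]
  rw [hS (x 1) (x 0)]
  ring

/-- The `(2n-4)`-point function of the remaining points is dominated by their Wick functional
under `PairingLowerBound` (Newman's inequality for `n - 2 ≥ 2`; identities for `n - 2 ≤ 1`: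
`𝒢_0 = 1 = ⟨1⟩`, `𝒢_1[S₂](a,b) = S₂(a,b) = ⟨σ_aσ_b⟩`). [cite: AizenmanCMP1982, §12 eq. (12.2)] -/
theorem nPoint_removeFour₂_le_pairingSum {μ : Measure (SpinConfig (Site d))} [IsProbabilityMeasure μ]
    (hlow : PairingLowerBound μ) {n : ℕ} (x : Fin (2 * n) → Site d)
    (s : {s : Finset (Fin (2 * n)) // s.card = 4}) :
    nPoint μ spinAt (removeFour₂ x s) ≤ pairingSum (twoPoint μ spinAt) (n - 2) (removeFour₂ x s) := by
  rcases Nat.lt_or_ge (n - 2) 2 with h | h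
  · generalize removeFour₂ x s = y
    revert y
    generalize n - 2 = m at h
    intro y
    interval_cases m
    · rw [pairingSum_zero]
      simp [nPoint]
    · rw [pairingSum_one _ (twoPoint_comm μ spinAt), twoPoint_eq_nPoint]
      apply le_of_eq
      congr 1
      funext l
      fin_cases l <;> rfl
  · exact hlow (n - 2) h _

/-- **The ADC-quoted form implies the source form.** If a state satisfies the tree's
`PairingUpperBound` (Aizenman–Duminil-Copin 2021, §6.3, first display: `S_{2n-4}` on the right)
together with `PairingLowerBound` (Newman) and has non-negative correlations (Griffiths I),
then it satisfies `WickDeviationBound` (Aizenman 1982, (12.3): `G_{2n-4}` on the right), because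
`0 ≤ -U₄ S_{2n-4} ≤ |U₄| G_{2n-4}` termwise. (The converse is not claimed.) [cite: AizenmanCMP1982, Prop. 12.1 and eq. (12.2)] [cite: AizenmanDuminilCopinAnnals2021, arXiv:1912.07973 §6.3, first display (p. 26)] -/
theorem PairingUpperBound.wickDeviationBound {μ : Measure (SpinConfig (Site d))}
    [IsProbabilityMeasure μ] (hup : PairingUpperBound μ) (hlow : PairingLowerBound μ)
    (hpos : ∀ {m : ℕ} (y : Fin m → Site d), 0 ≤ nPoint μ spinAt y) : WickDeviationBound μ := by
  intro n hn x
  have h0 : 0 ≤ pairingSum (twoPoint μ spinAt) n x - nPoint μ spinAt x := sub_nonneg.mpr (hlow n hn x)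
  rw [abs_sub_comm, abs_of_nonneg h0]
  refine (hup n hn x).trans ?_
  rw [wickRemainder, neg_mul, ← mul_neg, ← Finset.sum_neg_distrib]
  refine mul_le_mul_of_nonneg_left (Finset.sum_le_sum fun s _ => ?_) (by norm_num)
  have hrem : nPoint μ spinAt (removeFour x s) = nPoint μ spinAt (removeFour₂ x s) := by
    unfold removeFour₂ nPoint
    refine integral_congr_ae (Eventually.of_forall fun σ => ?_)
    exact (Fintype.prod_equiv (finCongr (two_mul_sub_two n))
      (fun j : Fin (2 * (n - 2)) => spinAt ((removeFour x s ∘ Fin.cast (two_mul_sub_two n)) j) σ)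
      (fun i : Fin (2 * n - 4) => spinAt (removeFour x s i) σ) fun _ => rfl).symm
  have hS0 : 0 ≤ nPoint μ spinAt (removeFour₂ x s) := hpos _
  calc -(nPoint μ spinAt (removeFour x s) * connectedFour μ spinAt (restrictFour x s))
      = -connectedFour μ spinAt (restrictFour x s) * nPoint μ spinAt (removeFour₂ x s) := by
        rw [hrem]; ring
    _ ≤ |connectedFour μ spinAt (restrictFour x s)| * nPoint μ spinAt (removeFour₂ x s) :=
        mul_le_mul_of_nonneg_right (neg_le_abs _) hS0
    _ ≤ |connectedFour μ spinAt (restrictFour x s)| *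
          pairingSum (twoPoint μ spinAt) (n - 2) (removeFour₂ x s) :=
        mul_le_mul_of_nonneg_left (nPoint_removeFour₂_le_pairingSum hlow x s) (abs_nonneg _)

end State


/-! ### Part 4. Smearing: the moment-level bound from `WickDeviationBound` -/

section Smearing

variable {d : ℕ}

/-- Reindexing a sum over `Λ^m` along `Fin.cast`. [folklore] -/
theorem sum_piFinset_prod_mul_comp_cast {α : Type*} {k m : ℕ} (h : k = m) (Λ : Finset α)
    (w : α → ℝ) (F : (Fin k → α) → ℝ) :
    ∑ q ∈ Fintype.piFinset (fun _ : Fin m => Λ), (∏ j, w (q j)) * F (q ∘ Fin.cast h) =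
      ∑ q ∈ Fintype.piFinset (fun _ : Fin k => Λ), (∏ j, w (q j)) * F q := by
  subst h
  rfl

/-- **Smearing the source form of Aizenman's inequality.** If `μ` satisfies Newman's Gaussian
domination (`PairingLowerBound μ`) and Aizenman's Prop. 12.1 (`WickDeviationBound μ`), then
for `L > 0`, `f ∈ C_0(ℝ^d)` vanishing outside `[-r,r]^d` and `n ≥ 2`,
`|⟨T_{f,L}^{2n}⟩ - (2n)!/(2ⁿn!) ⟨T_{f,L}²⟩ⁿ|
  ≤ (3/2) (2n)⁴ ‖f‖_∞⁴ S(μ; L, r) · (2n-4)!/(2^{n-2}(n-2)!) ⟨T_{|f|,L}²⟩^{n-2}`: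
multiply the pointwise inequality by `∏ᵢ f(xᵢ/L)`, move absolute values inside using
`𝒢_n - S_{2n} ≥ 0`, factor the sum over `x ∈ Λ^{2n}` along each `4`-subset of the indices
(`C(2n,4) ≤ (2n)⁴`), and evaluate the smeared Wick functional of the remaining `2n-4` points
as the Gaussian moment `(2n-4)!/(2^{n-2}(n-2)!) ⟨T_{|f|,L}²⟩^{n-2}` (`sum_prod_mul_pairingSum`).
This is Aizenman's route (CDM 2020, (7.6): `… ≤ (3/2) C(2n,4) R_L ⟨T^{2n-4}⟩` for the Gaussian
reference moments, and (7.9)–(7.10) for general `f`, with `|f|` in the prefactor); compare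
`abs_integral_normalizedField_pow_sub_le_of_pairingBounds` (`HighDimTrivialityWick`), the same
computation from the ADC-quoted form. [cite: AizenmanCDM2020, §7 eqs. (7.6), (7.9)–(7.10)] [cite: AizenmanCMP1982, Prop. 12.1] [cite: Panis2023Triviality, proof of Thm. 5.5, first display (p. 21)] -/
theorem abs_integral_normalizedField_pow_sub_le_of_wickBounds
    {μ : Measure (SpinConfig (Site d))} [IsProbabilityMeasure μ] (hlow : PairingLowerBound μ)
    (hW : WickDeviationBound μ) {L r : ℝ} (hL : 0 < L)
    {f : EuclideanSpace ℝ (Fin d) → ℝ} (hf : Continuous f) (hfr : ∀ x, f x ≠ 0 → ∀ i, |x i| ≤ r)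
    {n : ℕ} (hn : 2 ≤ n) :
    |(∫ σ, normalizedField μ L f σ ^ (2 * n) ∂μ) -
        ((2 * n)! : ℝ) / (2 ^ n * n !) * (∫ σ, normalizedField μ L f σ ^ 2 ∂μ) ^ n|
      ≤ 3 / 2 * (2 * n : ℝ) ^ 4 * (⨆ x, |f x|) ^ 4 * ursellFourSum μ L r *
          (((2 * (n - 2))! : ℝ) / (2 ^ (n - 2) * (n - 2)!) *
            (∫ σ, normalizedField μ L (fun x => |f x|) σ ^ 2 ∂μ) ^ (n - 2)) := by
  have hLne : L ≠ 0 := hL.ne'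
  have hfar : ∀ x, (fun y => |f y|) x ≠ 0 → ∀ i, |x i| ≤ r := fun x hx =>
    hfr x (abs_ne_zero.mp hx)
  have hbox : latticeBox d (r / |L⁻¹|) = latticeBox d (r * L) := by
    rw [abs_inv, abs_of_pos hL, div_inv_eq_mul]
  have hV0 : 0 ≤ ∫ σ, normalizedField μ L (fun x => |f x|) σ ^ 2 ∂μ :=
    integral_nonneg fun σ => sq_nonneg _
  have hfac0 : 0 ≤ ((2 * (n - 2))! : ℝ) / (2 ^ (n - 2) * (n - 2)!) := by positivity
  -- Step 1: the deviation identity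
  rw [integral_normalizedField_pow_sub_wick μ hLne hfr n]
  -- notation
  set Λ : Finset (Site d) := latticeBox d (r / |L⁻¹|) with hΛ
  set c : ℝ := (Real.sqrt (blockSpinVariance μ L))⁻¹ with hc
  set g : Site d → ℝ := fun a => f (L⁻¹ • siteVec a) with hg
  set G : (Fin (2 * n) → Site d) → ℝ := fun p => pairingSum (twoPoint μ spinAt) n p with hG
  set U : (Fin 4 → Site d) → ℝ := fun u => connectedFour μ spinAt u with hU
  set A : ℝ := ∑ q ∈ Fintype.piFinset (fun _ : Fin (2 * (n - 2)) => Λ),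
    (∏ j, |g (q j)|) * pairingSum (twoPoint μ spinAt) (n - 2) q with hA
  set B : ℝ := ∑ u ∈ Fintype.piFinset (fun _ : Fin 4 => Λ), (∏ j, |g (u j)|) * |U u| with hB
  set Us : ℝ := ∑ u ∈ Fintype.piFinset (fun _ : Fin 4 => Λ), |U u| with hUs
  set M : ℝ := ⨆ x, |f x| with hM
  have hM0 : 0 ≤ M := iSup_abs_nonneg f
  have hgM : ∀ a, |g a| ≤ M := by
    have hbdd : BddAbove (Set.range fun x => |f x|) :=
      (hf.abs).bddAbove_range_of_hasCompactSupport
        ((hasCompactSupport_of_cube hfr).comp_left abs_zero)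
    intro a
    exact le_ciSup hbdd _
  have hc0 : 0 ≤ c := inv_nonneg.mpr (Real.sqrt_nonneg _)
  have hSig0 : 0 ≤ blockSpinVariance μ L := integral_nonneg fun σ => sq_nonneg _
  -- the variance of `T_{|f|,L}` as a smeared two-point sum
  have hVeq : (∫ σ, normalizedField μ L (fun x => |f x|) σ ^ 2 ∂μ) =
      c ^ 2 * ∑ a ∈ Λ, ∑ b ∈ Λ, |g a| * |g b| * twoPoint μ spinAt a b := by
    rw [integral_normalizedField_sq_eq_sum₂ μ hLne hfar]
  -- the smeared Wick functional of the remaining points is a Gaussian moment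
  have hAeq : A = ((2 * (n - 2))! : ℝ) / (2 ^ (n - 2) * (n - 2)!) *
      (∑ a ∈ Λ, ∑ b ∈ Λ, |g a| * |g b| * twoPoint μ spinAt a b) ^ (n - 2) :=
    sum_prod_mul_pairingSum Λ (fun a => |g a|) (twoPoint μ spinAt) (n - 2)
  have hS : ursellFourSum μ L r = Us / blockSpinVariance μ L ^ 2 := by
    rw [ursellFourSum, hUs, hbox]
  have hS0 : 0 ≤ ursellFourSum μ L r := ursellFourSum_nonneg μ L r
  have hB : B ≤ M ^ 4 * Us := by
    rw [hB, hUs, Finset.mul_sum]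
    refine Finset.sum_le_sum fun u _ => ?_
    have hprod : ∏ j, |g (u j)| ≤ M ^ 4 := by
      calc ∏ j, |g (u j)| ≤ ∏ _j : Fin 4, M :=
            Finset.prod_le_prod (fun j _ => abs_nonneg _) fun j _ => hgM _
        _ = M ^ 4 := by rw [Finset.prod_const, Finset.card_univ, Fintype.card_fin]
    exact mul_le_mul_of_nonneg_right hprod (abs_nonneg _)
  -- the right-hand side is non-negative
  have hRHS0 : 0 ≤ 3 / 2 * (2 * n : ℝ) ^ 4 * M ^ 4 * ursellFourSum μ L r *
      (((2 * (n - 2))! : ℝ) / (2 ^ (n - 2) * (n - 2)!) *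
        (∫ σ, normalizedField μ L (fun x => |f x|) σ ^ 2 ∂μ) ^ (n - 2)) :=
    mul_nonneg (mul_nonneg (mul_nonneg (mul_nonneg (by norm_num) (pow_nonneg (by positivity) 4))
      (pow_nonneg hM0 4)) hS0) (mul_nonneg hfac0 (pow_nonneg hV0 _))
  -- the pointwise bounds
  have hdev : ∀ p : Fin (2 * n) → Site d,
      0 ≤ G p - nPoint μ spinAt p ∧
        G p - nPoint μ spinAt p ≤ 3 / 2 * ∑ s : {s : Finset (Fin (2 * n)) // s.card = 4},
          |U (restrictFour p s)| * pairingSum (twoPoint μ spinAt) (n - 2) (removeFour₂ p s) :=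
    fun p =>
    ⟨sub_nonneg.mpr (hlow n hn p), by
      have h := hW n hn p
      rw [abs_sub_comm] at h
      exact (le_abs_self _).trans h⟩
  -- Step 2: absolute values inside, pointwise bound, and factorisation along each 4-subset
  have hsum : |∑ p ∈ Fintype.piFinset (fun _ : Fin (2 * n) => Λ),
      (∏ i, g (p i)) * (nPoint μ spinAt p - G p)| ≤
      3 / 2 * ((Fintype.card {s : Finset (Fin (2 * n)) // s.card = 4} : ℝ) * (A * B)) := by
    calc |∑ p ∈ Fintype.piFinset (fun _ : Fin (2 * n) => Λ),
          (∏ i, g (p i)) * (nPoint μ spinAt p - G p)|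
        ≤ ∑ p ∈ Fintype.piFinset (fun _ : Fin (2 * n) => Λ),
            (∏ i, |g (p i)|) * (G p - nPoint μ spinAt p) := by
          refine (Finset.abs_sum_le_sum_abs _ _).trans (le_of_eq (Finset.sum_congr rfl fun p _ => ?_))
          rw [abs_mul, Finset.abs_prod, ← abs_neg, neg_sub, abs_of_nonneg (hdev p).1]
      _ ≤ ∑ p ∈ Fintype.piFinset (fun _ : Fin (2 * n) => Λ),
            (∏ i, |g (p i)|) * (3 / 2 * ∑ s : {s : Finset (Fin (2 * n)) // s.card = 4},
              |U (restrictFour p s)| * pairingSum (twoPoint μ spinAt) (n - 2) (removeFour₂ p s)) :=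
          Finset.sum_le_sum fun p _ => mul_le_mul_of_nonneg_left (hdev p).2
            (Finset.prod_nonneg fun i _ => abs_nonneg _)
      _ = 3 / 2 * ∑ s : {s : Finset (Fin (2 * n)) // s.card = 4},
            ∑ p ∈ Fintype.piFinset (fun _ : Fin (2 * n) => Λ),
              (∏ i, |g (p i)|) *
                ((fun q : Fin (2 * n - 4) → Site d =>
                    pairingSum (twoPoint μ spinAt) (n - 2) (q ∘ Fin.cast (two_mul_sub_two n)))
                    (removeFour p s) * (fun u => |U u|) (restrictFour p s)) := by
          rw [Finset.sum_comm, Finset.mul_sum]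
          refine Finset.sum_congr rfl fun p _ => ?_
          rw [Finset.mul_sum, Finset.mul_sum, Finset.mul_sum]
          refine Finset.sum_congr rfl fun s _ => ?_
          simp only [removeFour₂]
          ring
      _ = 3 / 2 * ∑ _s : {s : Finset (Fin (2 * n)) // s.card = 4}, A * B := by
          congr 1
          refine Finset.sum_congr rfl fun s _ => ?_
          rw [sum_prod_mul_removeFour_mul_restrictFour Λ (fun a => |g a|)
            (fun q : Fin (2 * n - 4) → Site d =>
              pairingSum (twoPoint μ spinAt) (n - 2) (q ∘ Fin.cast (two_mul_sub_two n)))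
            (fun u => |U u|) s,
            sum_piFinset_prod_mul_comp_cast (two_mul_sub_two n) Λ (fun a => |g a|)
              (fun q => pairingSum (twoPoint μ spinAt) (n - 2) q)]
      _ = 3 / 2 * ((Fintype.card {s : Finset (Fin (2 * n)) // s.card = 4} : ℝ) * (A * B)) := by
          rw [Finset.sum_const, Finset.card_univ, nsmul_eq_mul]
  -- Step 3: the case `Σ_L = 0` (then `c = 0` and the left-hand side vanishes)
  rcases hSig0.eq_or_lt with hSig | hSig
  · have hc' : c = 0 := by rw [hc, ← hSig, Real.sqrt_zero, inv_zero]
    rw [hc', zero_pow (by omega), zero_mul, abs_zero]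
    exact hRHS0
  -- Step 4: `Σ_L > 0`: normalise by `c^{2n} = c^{2(n-2)} c⁴`, `c⁴ = Σ_L⁻²`, `c² ΣΣ = ⟨T_{|f|,L}²⟩`
  have hcpos : 0 < c := inv_pos.mpr (Real.sqrt_pos.mpr hSig)
  have hc4 : c ^ 4 = (blockSpinVariance μ L ^ 2)⁻¹ := by
    rw [hc, inv_pow, show (4 : ℕ) = 2 * 2 from rfl, pow_mul, Real.sq_sqrt hSig0]
  have hT2 : 0 ≤ ∑ a ∈ Λ, ∑ b ∈ Λ, |g a| * |g b| * twoPoint μ spinAt a b := by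
    have h1 : ∑ a ∈ Λ, ∑ b ∈ Λ, |g a| * |g b| * twoPoint μ spinAt a b =
        (∫ σ, normalizedField μ L (fun x => |f x|) σ ^ 2 ∂μ) / c ^ 2 := by
      rw [hVeq]; field_simp
    rw [h1]
    exact div_nonneg hV0 (pow_nonneg hc0 2)
  have hA0 : 0 ≤ A := by
    rw [hAeq]
    exact mul_nonneg hfac0 (pow_nonneg hT2 _)
  have hcard := (card_fourSubsets_le (n := n))
  have hcsplit : c ^ (2 * n) = c ^ (2 * (n - 2)) * c ^ 4 := by
    rw [← pow_add]; congr 1; omega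
  have hcA : c ^ (2 * (n - 2)) * A = ((2 * (n - 2))! : ℝ) / (2 ^ (n - 2) * (n - 2)!) *
      (∫ σ, normalizedField μ L (fun x => |f x|) σ ^ 2 ∂μ) ^ (n - 2) := by
    rw [hAeq, hVeq, mul_pow, ← pow_mul]; ring
  rw [abs_mul, abs_of_nonneg (pow_nonneg hc0 _), hcsplit]
  calc c ^ (2 * (n - 2)) * c ^ 4 * |∑ p ∈ Fintype.piFinset (fun _ : Fin (2 * n) => Λ),
        (∏ i, g (p i)) * (nPoint μ spinAt p - G p)|
      ≤ c ^ (2 * (n - 2)) * c ^ 4 *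
          (3 / 2 * ((Fintype.card {s : Finset (Fin (2 * n)) // s.card = 4} : ℝ) * (A * B))) :=
        mul_le_mul_of_nonneg_left hsum (by positivity)
    _ = 3 / 2 * (Fintype.card {s : Finset (Fin (2 * n)) // s.card = 4} : ℝ) *
          (c ^ (2 * (n - 2)) * A) * (c ^ 4 * B) := by ring
    _ ≤ 3 / 2 * (Fintype.card {s : Finset (Fin (2 * n)) // s.card = 4} : ℝ) *
          (c ^ (2 * (n - 2)) * A) * (c ^ 4 * (M ^ 4 * Us)) :=
        mul_le_mul_of_nonneg_left (mul_le_mul_of_nonneg_left hB (pow_nonneg hc0 4))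
          (mul_nonneg (mul_nonneg (by norm_num) (Nat.cast_nonneg _))
            (mul_nonneg (pow_nonneg hc0 _) hA0))
    _ ≤ 3 / 2 * (2 * n : ℝ) ^ 4 * (c ^ (2 * (n - 2)) * A) * (c ^ 4 * (M ^ 4 * Us)) :=
        mul_le_mul_of_nonneg_right (mul_le_mul_of_nonneg_right
          (mul_le_mul_of_nonneg_left hcard (by norm_num)) (mul_nonneg (pow_nonneg hc0 _) hA0))
          (mul_nonneg (pow_nonneg hc0 4) (mul_nonneg (pow_nonneg hM0 4)
            (Finset.sum_nonneg fun u _ => abs_nonneg _)))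
    _ = 3 / 2 * (2 * n : ℝ) ^ 4 * M ^ 4 * ursellFourSum μ L r *
          (((2 * (n - 2))! : ℝ) / (2 ^ (n - 2) * (n - 2)!) *
            (∫ σ, normalizedField μ L (fun x => |f x|) σ ^ 2 ∂μ) ^ (n - 2)) := by
        rw [hcA, hS, hc4, div_eq_mul_inv]
        ring

end Smearing

/-! ### Part 5. Summation over `n`: exponential moments -/

section Summation

/-- **Summation step (source form).** Let `X` be a bounded random variable on a probability
space whose odd moments vanish and whose even moments deviate from Wick's law by at most a
multiple of the *Gaussian* `(2n-4)`-th moment of variance `W`: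
`|E[X^{2n}] - (2n)!/(2ⁿn!) E[X²]ⁿ| ≤ (2n)⁴ E · (2n-4)!/(2^{n-2}(n-2)!) W^{n-2}` for `n ≥ 2`. Then
`|E[exp(zX)] - exp(z² E[X²]/2)| ≤ 16 E z⁴ exp(z² W/2)` for every real `z` (multiply by
`z^{2n}/(2n)!` and sum; `(2n)⁴/(2n)! ≤ 16/(2n-4)!`). This is the summation of Aizenman, CDM
2020, (7.6) ⇒ (7.7)/(7.9), and of ADC 2021 §6.3 / Panis 2023 Thm 5.5, in the form matching
Aizenman 1982, Prop. 12.1; compare `abs_mgf_sub_exp_le_of_moment_bounds`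
(`HighDimTrivialityMoments`), where the reference moments are those of a random variable `Y`.
[cite: AizenmanCDM2020, §7 eqs. (7.6)–(7.9)] [cite: AizenmanDuminilCopinAnnals2021, arXiv:1912.07973 §6.3 (p. 26)] -/
theorem abs_mgf_sub_exp_le_of_wickMoment_bounds {Ω : Type*} [MeasurableSpace Ω] {μ : Measure Ω}
    [IsProbabilityMeasure μ] {X : Ω → ℝ} (hXm : Measurable X)
    {K : ℝ} (hXb : ∀ ω, |X ω| ≤ K) {E W : ℝ} (hE : 0 ≤ E) (hW : 0 ≤ W)
    (hdev : ∀ n : ℕ, 2 ≤ n →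
      |(∫ ω, X ω ^ (2 * n) ∂μ) - ((2 * n)! : ℝ) / (2 ^ n * n !) * (∫ ω, X ω ^ 2 ∂μ) ^ n|
        ≤ (2 * n : ℝ) ^ 4 * E *
          (((2 * (n - 2))! : ℝ) / (2 ^ (n - 2) * (n - 2)!) * W ^ (n - 2)))
    (hodd : ∀ n : ℕ, ∫ ω, X ω ^ (2 * n + 1) ∂μ = 0) (z : ℝ) :
    |(∫ ω, Real.exp (z * X ω) ∂μ) - Real.exp (z ^ 2 / 2 * ∫ ω, X ω ^ 2 ∂μ)|
      ≤ 16 * E * z ^ 4 * Real.exp (z ^ 2 / 2 * W) := by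
  set V : ℝ := ∫ ω, X ω ^ 2 ∂μ with hV
  set m : ℕ → ℝ := fun k => ∫ ω, X ω ^ k ∂μ with hm
  set w : ℕ → ℝ := fun n => ((2 * n)! : ℝ) / (2 ^ n * n !) * W ^ n with hw
  have hm2 : m 2 = V := rfl
  -- even-moment series for the exponential moment of `X`
  have h1 : HasSum (fun k : ℕ => z ^ k / k ! * m k) (∫ ω, Real.exp (z * X ω) ∂μ) :=
    hasSum_integral_pow_div_factorial μ hXm hXb z
  have h2 : HasSum (fun n : ℕ => z ^ (2 * n) / (2 * n)! * m (2 * n))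
      (∫ ω, Real.exp (z * X ω) ∂μ) := by
    have key := (Function.Injective.hasSum_iff (mul_right_injective₀ (two_ne_zero' ℕ))
      (f := fun k : ℕ => z ^ k / k ! * m k) (a := ∫ ω, Real.exp (z * X ω) ∂μ) ?_).mpr h1
    · simpa only [Function.comp_def] using key
    · intro k hk
      rcases Nat.even_or_odd k with ⟨j, hj⟩ | ⟨j, hj⟩
      · exact absurd ⟨j, show 2 * j = k by omega⟩ hk
      · subst hj
        simp only [hm, hodd j, mul_zero]
  -- the Gaussian series `exp(z² a/2) = ∑ z^{2n}/(2n)! · (2n)!/(2ⁿ n!) aⁿ`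
  have hexp2 : ∀ a : ℝ, HasSum (fun n : ℕ => (z ^ 2 / 2 * a) ^ n / n !)
      (Real.exp (z ^ 2 / 2 * a)) := fun a => by
    rw [Real.exp_eq_exp_ℝ]
    exact NormedSpace.expSeries_div_hasSum_exp _
  have hterm : ∀ (a : ℝ) (n : ℕ), z ^ (2 * n) / (2 * n)! * (((2 * n)! : ℝ) / (2 ^ n * n !) * a ^ n)
      = (z ^ 2 / 2 * a) ^ n / n ! := fun a n => by
    have hn : ((2 * n)! : ℝ) ≠ 0 := by positivity
    rw [pow_mul, show z ^ 2 / 2 * a = z ^ 2 * a / 2 by ring, div_pow, mul_pow]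
    field_simp
  have h3 : HasSum (fun n : ℕ => z ^ (2 * n) / (2 * n)! * (((2 * n)! : ℝ) / (2 ^ n * n !) * V ^ n))
      (Real.exp (z ^ 2 / 2 * V)) := by
    simp_rw [hterm V]
    exact hexp2 V
  -- the difference series
  have h4 : HasSum (fun n : ℕ => z ^ (2 * n) / (2 * n)! *
      (m (2 * n) - ((2 * n)! : ℝ) / (2 ^ n * n !) * V ^ n))
      ((∫ ω, Real.exp (z * X ω) ∂μ) - Real.exp (z ^ 2 / 2 * V)) := by
    have h4' := h2.sub h3
    simp only [← mul_sub] at h4'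
    exact h4'
  -- the Gaussian majorant `z^{2n}/(2n)! w n = (z² W/2)ⁿ/n!`
  have hz2 : ∀ n : ℕ, 0 ≤ z ^ (2 * n) := fun n => by rw [pow_mul]; positivity
  have hw0 : ∀ n, 0 ≤ w n := fun n => by rw [hw]; positivity
  have hc_eq : ∀ n, z ^ (2 * n) / (2 * n)! * w n = (z ^ 2 / 2 * W) ^ n / n ! := fun n => by
    rw [← hterm W n]
  have hc_sum : HasSum (fun n => z ^ (2 * n) / (2 * n)! * w n) (Real.exp (z ^ 2 / 2 * W)) := by
    simp_rw [hc_eq]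
    exact hexp2 W
  -- the shifted majorant `b`
  set b : ℕ → ℝ := fun n => if n < 2 then 0 else
    16 * E * z ^ 4 * (z ^ (2 * (n - 2)) / (2 * (n - 2))! * w (n - 2)) with hb_def
  have hb : HasSum b (16 * E * z ^ 4 * Real.exp (z ^ 2 / 2 * W)) := by
    rw [← hasSum_nat_add_iff' 2]
    have h0 : ∑ i ∈ Finset.range 2, b i = 0 := by
      simp [hb_def, Finset.sum_range_succ]
    rw [h0, sub_zero]
    have hshift : (fun n => b (n + 2)) = fun n => 16 * E * z ^ 4 * (z ^ (2 * n) / (2 * n)! * w n) := by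
      funext n
      simp [hb_def]
    rw [hshift]
    exact hc_sum.mul_left _
  -- termwise domination
  have hab : ∀ n, |z ^ (2 * n) / (2 * n)! * (m (2 * n) - ((2 * n)! : ℝ) / (2 ^ n * n !) * V ^ n)|
      ≤ b n := by
    intro n
    rcases lt_or_ge n 2 with hn | hn
    · have h0 : m (2 * n) - ((2 * n)! : ℝ) / (2 ^ n * n !) * V ^ n = 0 := by
        interval_cases n
        · simp [hm]
        · rw [← hm2]
          norm_num [Nat.factorial]
      have hbn : b n = 0 := by rw [hb_def]; exact if_pos hn
      rw [h0, mul_zero, abs_zero, hbn]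
    · obtain ⟨k, rfl⟩ : ∃ k, n = k + 2 := ⟨n - 2, by omega⟩
      have hdevn := hdev (k + 2) hn
      have h2n4 : k + 2 - 2 = k := by omega
      rw [h2n4] at hdevn
      have hfacle := two_mul_pow_four_div_factorial_le k
      have hz4 : z ^ (2 * (k + 2)) = z ^ 4 * z ^ (2 * k) := by rw [← pow_add]; ring_nf
      have hbk : b (k + 2) = 16 * E * z ^ 4 * (z ^ (2 * k) / (2 * k)! * w k) := by
        simp [hb_def]
      have hwk : ((2 * k)! : ℝ) / (2 ^ k * k !) * W ^ k = w k := rfl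
      rw [hwk] at hdevn
      rw [hbk, abs_mul, abs_div, Nat.abs_cast, abs_of_nonneg (hz2 (k + 2))]
      calc z ^ (2 * (k + 2)) / (2 * (k + 2))! *
            |m (2 * (k + 2)) - ((2 * (k + 2))! : ℝ) / (2 ^ (k + 2) * (k + 2)!) * V ^ (k + 2)|
          ≤ z ^ (2 * (k + 2)) / (2 * (k + 2))! * ((2 * (k + 2 : ℕ) : ℝ) ^ 4 * E * w k) :=
            mul_le_mul_of_nonneg_left (by exact_mod_cast hdevn)
              (div_nonneg (hz2 _) (by positivity))
        _ = z ^ 4 * ((2 * (k + 2 : ℕ) : ℝ) ^ 4 / (2 * (k + 2))!) * (z ^ (2 * k) * E * w k) := by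
            rw [hz4]; ring
        _ ≤ z ^ 4 * (16 / (2 * k)!) * (z ^ (2 * k) * E * w k) :=
            mul_le_mul_of_nonneg_right
              (mul_le_mul_of_nonneg_left hfacle (by positivity))
              (mul_nonneg (mul_nonneg (hz2 k) hE) (hw0 k))
        _ = 16 * E * z ^ 4 * (z ^ (2 * k) / (2 * k)! * w k) := by ring
  -- conclusion: `|D| ≤ 16 E z⁴ exp(z² W/2)`
  have hup := hasSum_le (fun n => (le_abs_self _).trans (hab n)) h4 hb
  have hlow := hasSum_le (fun n => (neg_le.mpr ((neg_le_abs _).trans (hab n)) : -b n ≤ _)) hb.neg h4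
  rw [abs_le]
  exact ⟨by linarith, by linarith⟩

variable {d : ℕ}

/-- **The exponential-moment bound, one state, one test function (source form of the
random-current input).** For a probability measure `μ` on spin configurations of `ℤ^d`
satisfying Newman's Gaussian domination (`PairingLowerBound μ`) and Aizenman's Prop. 12.1
(`WickDeviationBound μ`) and having vanishing odd correlations, for `L > 0`, `f ∈ C_0(ℝ^d)`
vanishing outside `[-r,r]^d` and real `z`:
`|⟨exp(z T_{f,L})⟩_μ - exp(z²/2 ⟨T_{f,L}²⟩_μ)| ≤ exp(z²/2 ⟨T_{|f|,L}²⟩_μ) · 24 ‖f‖_∞⁴ S(μ; L, r) z⁴`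
— the third display of Aizenman–Duminil-Copin 2021, §6.3 (p. 26) / Aizenman CDM 2020, (7.9),
with `S(μ;L,r) = ursellFourSum μ L r`, `C₁ = 24`. Same shape and constant as
`abs_mgf_normalizedField_sub_exp_le_of_pairingBounds` (`HighDimTrivialityWick`), whose input was
the ADC-quoted form of the inequality. [cite: AizenmanCDM2020, §7 eq. (7.9)] [cite: AizenmanDuminilCopinAnnals2021, arXiv:1912.07973 §6.3, third display (p. 26)] -/
theorem abs_mgf_normalizedField_sub_exp_le_of_wickBounds
    {μ : Measure (SpinConfig (Site d))} [IsProbabilityMeasure μ]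
    (hlow : PairingLowerBound μ) (hW : WickDeviationBound μ)
    (hodd : ∀ {n : ℕ}, Odd n → ∀ x : Fin n → Site d, ∫ σ, ∏ i, spinAt (x i) σ ∂μ = 0)
    {L r : ℝ} (hL : 0 < L) {f : EuclideanSpace ℝ (Fin d) → ℝ} (hf : Continuous f)
    (hfr : ∀ x, f x ≠ 0 → ∀ i, |x i| ≤ r) (z : ℝ) :
    |(∫ σ, Real.exp (z * normalizedField μ L f σ) ∂μ) -
        Real.exp (z ^ 2 / 2 * ∫ σ, normalizedField μ L f σ ^ 2 ∂μ)|
      ≤ Real.exp (z ^ 2 / 2 * ∫ σ, normalizedField μ L (fun x => |f x|) σ ^ 2 ∂μ) *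
          (24 * (⨆ x, |f x|) ^ 4 * ursellFourSum μ L r * z ^ 4) := by
  have hLne : L ≠ 0 := hL.ne'
  set E : ℝ := 3 / 2 * (⨆ x, |f x|) ^ 4 * ursellFourSum μ L r with hE_def
  have hE : 0 ≤ E :=
    mul_nonneg (mul_nonneg (by norm_num) (pow_nonneg (iSup_abs_nonneg f) 4))
      (ursellFourSum_nonneg μ L r)
  have hVabs : 0 ≤ ∫ σ, normalizedField μ L (fun x => |f x|) σ ^ 2 ∂μ :=
    integral_nonneg fun σ => sq_nonneg _
  have key := abs_mgf_sub_exp_le_of_wickMoment_bounds (μ := μ) (X := normalizedField μ L f)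
    (measurable_normalizedField μ hLne hfr) (abs_normalizedField_le μ hLne hfr) hE hVabs ?_ ?_ z
  · calc _ ≤ 16 * E * z ^ 4 *
          Real.exp (z ^ 2 / 2 * ∫ σ, normalizedField μ L (fun x => |f x|) σ ^ 2 ∂μ) := key
      _ = _ := by rw [hE_def]; ring
  · intro n hn
    calc _ ≤ _ := abs_integral_normalizedField_pow_sub_le_of_wickBounds hlow hW hL hf hfr hn
      _ = _ := by rw [hE_def]; ring
  · intro n
    rw [integral_normalizedField_pow μ hLne hfr (2 * n + 1)]
    refine mul_eq_zero_of_right _ (Finset.sum_eq_zero fun p _ => ?_)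
    rw [hodd ⟨n, rfl⟩ p, mul_zero]

end Summation

/-! ### Part 6. ADC Prop. 1.4 (in the form its proof establishes) from the source form -/

section DLR

variable {d : ℕ}

/-- **The two random-current inputs for a state with the free correlations, from Aizenman's
Prop. 12.1 in finite volume.** If `spinCorr μ A = ⟨σ_A⟩^∅_{β,0}` for all `A` (`β ≥ 0`), then
`μ` satisfies `PairingLowerBound` (Newman; a theorem of the tree in finite volume,
`aizenman_nPoint_le_pairingSum_finite_holds`) and, granted `aizenman_wickDeviation_le_finite`,
`WickDeviationBound`. [cite: AizenmanCMP1982, Prop. 12.1 and eq. (12.2)] -/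
theorem pairingLowerBound_and_wickDeviationBound_of_freeCorr (hW : aizenman_wickDeviation_le_finite)
    {β : ℝ} (hβ : 0 ≤ β) {μ : Measure (SpinConfig (Site d))}
    (hcorr : ∀ A : Finset (Site d), spinCorr μ A = freeCorr d β 0 A) :
    PairingLowerBound μ ∧ WickDeviationBound μ :=
  ⟨pairingLowerBound_of_finite aizenman_nPoint_le_pairingSum_finite_holds hβ hcorr,
    wickDeviationBound_of_finite hW hβ hcorr⟩

/-- **Aizenman–Duminil-Copin 2021, Prop. 1.4 in the form its proof establishes
(`aizenmanDuminilCopin_mgf_normalizedField_bound_abs`), from the source form of Aizenman's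
inequality.** Inputs: Aizenman 1982, Prop. 12.1 in finite volume
(`aizenman_wickDeviation_le_finite`); the `d = 4` bound on `∑ |U₄|` in the critical window
(`aizenmanDuminilCopin_ursellFourSum_le`, ADC Thm 1.3 with §6.3); uniqueness of the Gibbs state
below and at `β_c` (`hasUniqueGibbsMeasure_of_lt_criticalBeta`,
`hasUniqueGibbsMeasure_criticalBeta`), which identify every `μ ∈ 𝒢(β,0)`, `β ≤ β_c(4)`, with
the free state (a theorem of the tree: `exists_freeMeasure_holds`), to which the finite-volume
inequalities pass in the limit; Newman's lower half and the flip symmetry are theorems. This is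
the corrected counterpart of `aizenmanDuminilCopin_mgf_normalizedField_bound_abs_of_finite`
(`HighDimTrivialityWick`), whose random-current input was the ADC-quoted form
`aizenman_pairingSum_sub_nPoint_le_finite`. [cite: AizenmanDuminilCopinAnnals2021, arXiv:1912.07973 Prop. 1.4 (p. 6) and §6.3 (p. 26)] [cite: AizenmanCMP1982, Prop. 12.1] -/
theorem aizenmanDuminilCopin_mgf_normalizedField_bound_abs_of_wickDeviation
    (hW : aizenman_wickDeviation_le_finite)
    (hS : aizenmanDuminilCopin_ursellFourSum_le)
    (hU₁ : ∀ {d : ℕ} {β : ℝ}, hasUniqueGibbsMeasure_of_lt_criticalBeta (d := d) (β := β))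
    (hU₂ : ∀ {d : ℕ}, hasUniqueGibbsMeasure_criticalBeta (d := d)) :
    aizenmanDuminilCopin_mgf_normalizedField_bound_abs := by
  classical
  obtain ⟨c, C, hc, hC, H⟩ := hS
  refine ⟨c, 24 * C, hc, by positivity, fun β L r hβ hβc hreg hL hr μ hμ f hf hfr z => ?_⟩
  haveI : IsProbabilityMeasure μ := hμ.1
  have hSle := H β L r hβ hβc hreg hL hr μ hμ
  -- `μ` is the free state
  obtain ⟨μf, hμf, -, hcorr⟩ := exists_freeMeasure_holds 4 (β := β) 0 hβ le_rfl
  have huniq : HasUniqueGibbsMeasure (isingSpecification (zdGraph 4) β 0) := by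
    rcases hβc.lt_or_eq with hlt | heq
    · exact hU₁ (by norm_num) hβ hlt
    · rw [heq]
      exact hU₂ (by norm_num)
  have hμeq : μ = μf := huniq.1 hμ hμf
  subst hμeq
  obtain ⟨hlow, hWμ⟩ := pairingLowerBound_and_wickDeviationBound_of_freeCorr hW hβ hcorr
  -- odd correlations vanish: finite-volume flip symmetry passed to the box limit
  have hodd : ∀ {n : ℕ}, Odd n → ∀ x : Fin n → Site 4, ∫ σ, ∏ i, spinAt (x i) σ ∂μ = 0 := by
    intro n hn x
    obtain ⟨A, hA, hprod⟩ := exists_prod_spinAt_eq_spinProduct hn x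
    simp_rw [hprod]
    rw [show (∫ σ, spinProduct A σ ∂μ) = spinCorr μ A from rfl, hcorr A]
    have hlim := hasBoxLimit_isingCorr_free_holds (d := 4) hβ le_rfl A
    obtain ⟨L₀, hL₀⟩ := exists_forall_subset_box 4 A
    refine tendsto_nhds_unique hlim (tendsto_const_nhds.congr' ?_)
    filter_upwards [eventually_ge_atTop L₀] with L' hL'
    exact (isingCorr_free_of_odd_card_holds (zdGraph 4) (box 4 L') β (hL₀ L' hL') hA).symm
  have key := abs_mgf_normalizedField_sub_exp_le_of_wickBounds hlow hWμ hodd (one_pos.trans hL)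
    hf hfr z (r := r)
  refine key.trans (mul_le_mul_of_nonneg_left ?_ (Real.exp_pos _).le)
  have h0 : 0 ≤ (⨆ x, |f x|) ^ 4 := pow_nonneg (iSup_abs_nonneg f) 4
  have hz : 0 ≤ z ^ 4 := by positivity
  calc 24 * (⨆ x, |f x|) ^ 4 * ursellFourSum μ L r * z ^ 4
      ≤ 24 * (⨆ x, |f x|) ^ 4 * (C * r ^ 12 / Real.log L ^ c) * z ^ 4 := by gcongr
    _ = 24 * C * (⨆ x, |f x|) ^ 4 * r ^ 12 * z ^ 4 / Real.log L ^ c := by ring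

end DLR

end Literature.Probability.LatticeModels
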